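import Summits.BirchSwinnertonDyer.BirchSwinnertonDyer.Theorems.UniversalToricDescentSigmaLocalStabilizer
import Summits.BirchSwinnertonDyer.Rank1Residual.X11b.BDPRouteControlStrictPlace
import HarnessLib

/-!
# `v`-signatures of anticyclotomic Selmer classes: kernel of the signature map, and DIVISION of signatures
# (helpers for stub TS2-ASSEMBLY of line `sigmacongruence`, crux ♭T≤ stmt-BirchSwinnertonDyer-23042)

Lead prover `bsd-wall-utd-p1` g17 (`--supports stmt-BirchSwinnertonDyer-23042 --as helper`). THEOREMS ONLY; no definition,
no named fact, no `sorry`; no route file imported. BSD is not proved by any of this.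

For `W/K`, a `ℤ_p`-extension `κ` and a place `v` finitely decomposed in `K_∞` (`D_v ⊄ ker κ`), a `v`-SIGNATURE is a
right-`ker κ`-invariant, left-`D_v`-equivariant `F : Γ_K → H¹(kerD κ v, E[p^∞])` (an element of `⊕_{w∣v} H¹(K_{∞,w}, E[p^∞])`).

* `sig_of_mem` — the signature `σ ↦ res_{kerD κ v}(conj_σ s)` of a class `s ∈ H¹(K_∞, E[p^∞])` is a `v`-signature;
* `mem_selmerAc_of_forall_resKerD_eq_zero` — a class of `Sel_𝔭^{S∪{v}}(K_∞)` with zero `v`-signature lies in `Sel_𝔭^{S}(K_∞)`;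
* `exists_decomp_mul_pow_mul_mem_ker_lt` — `σ = d γ^i h` with `i < p^c` (bounded form of
  `UniversalToricDescentSigmaLocalStabilizer.exists_decomp_mul_pow_mul_mem_ker`);
* `exists_sig_smul_eq` — if `H¹(kerD κ v, E[p^∞])` is `p`-divisible, so is the group of `v`-signatures;
* `finite_torsionBy_pow` — `Y[n]` finite ⇒ `Y[n^k]` finite (abstract additive subgroup).

References: [GreenbergVatsal2000] §2 p. 24; [Washington1997] §13.1; [Castella2018] Def. 2.2.
-/

set_option autoImplicit false
-- `…BirchSwinnertonDyer.BirchSwinnertonDyer.Theorems…` is the problem's mandated namespace (D-0017).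
set_option linter.dupNamespace false

noncomputable section

open scoped Classical

namespace Summit.BirchSwinnertonDyer.BirchSwinnertonDyer.Theorems.UniversalToricDescentTwinSignatureDivision

open WeierstrassCurve NumberField IsDedekindDomain Field
  Literature.NumberTheory.EllipticCurves
  Literature.NumberTheory.EllipticCurves.GreenbergSelmer
  Literature.NumberTheory.GaloisRepresentations
  Summit.BirchSwinnertonDyer.Rank1Residual Summit.BirchSwinnertonDyer.Rank1Residual.X11b
  Summit.BirchSwinnertonDyer.Rank1Residual.X11b.AcSelmer Summit.BirchSwinnertonDyer.Rank1Residual.X11b.Coinv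
  Summit.BirchSwinnertonDyer.BirchSwinnertonDyer.Theorems

section Generic

variable {K : Type} [Field K] [NumberField K] (W : WeierstrassCurve K) (p : ℕ) [Fact p.Prime]
  (κ : ZpExtension K p) (v : HeightOneSpectrum (𝓞 K))

/-- **Every `σ ∈ Γ_K` is `d · γ^i · h` with `d ∈ D_v`, `i < p^c`, `h ∈ ker κ`** as soon as `κ(D_v) ⊇ p^c ℤ_p`
(`i` = the residue `PadicInt.appr` of `κ σ` modulo `p^c`; `γ` a topological generator, `κ γ = 1`). Bounded form of
`UniversalToricDescentSigmaLocalStabilizer.exists_decomp_mul_pow_mul_mem_ker`. [cite: Washington1997, §13.1] -/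
theorem exists_decomp_mul_pow_mul_mem_ker_lt {γ : absoluteGaloisGroup K} (hγ : κ.IsTopGenerator γ) {c : ℕ}
    (hc : ∀ z : ℤ_[p], ∃ d : decomp (K := K) v,
      (κ (d : absoluteGaloisGroup K)).toAdd = (p : ℤ_[p]) ^ c * z)
    (σ : absoluteGaloisGroup K) :
    ∃ (d : decomp (K := K) v) (i : ℕ) (h : absoluteGaloisGroup K), i < p ^ c ∧ h ∈ κ.kerSubgroup ∧
      σ = d * γ ^ i * h := by
  set x : ℤ_[p] := (κ σ).toAdd with hx
  obtain ⟨z, hz⟩ := Ideal.mem_span_singleton.mp (PadicInt.appr_spec c x)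
  obtain ⟨d, hd⟩ := hc z
  refine ⟨d, x.appr c, ((d : absoluteGaloisGroup K) * γ ^ x.appr c)⁻¹ * σ, PadicInt.appr_lt x c, ?_, ?_⟩
  · rw [ZpExtension.mem_kerSubgroup, map_mul, map_inv, map_mul, map_pow,
      show κ γ = Multiplicative.ofAdd 1 from hγ, ← ofAdd_nsmul]
    apply Multiplicative.toAdd.injective
    rw [toAdd_mul, toAdd_inv, toAdd_mul, toAdd_ofAdd, toAdd_one, hd, nsmul_eq_mul, mul_one, ← hx]
    linear_combination hz
  · rw [mul_inv_cancel_left]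


/-- The `v`-signature `σ ↦ res_{kerD κ v}(conj_σ s)` of a class `s ∈ H¹(K_∞, E[p^∞])` is right-`ker κ`-invariant
(inner conjugations act trivially) and left-`D_v`-equivariant (`resKerD_conjH1`). [cite: GreenbergVatsal2000, §2 p. 24] -/
theorem sig_of_mem (s : W.subgroupH1 p κ.kerSubgroup) :
    (∀ (σ h : absoluteGaloisGroup K), h ∈ κ.kerSubgroup →
      resKerD κ (W.geomPrimaryTorsion p) v (W.conjH1 p κ.kerSubgroup (σ * h) s) =
        resKerD κ (W.geomPrimaryTorsion p) v (W.conjH1 p κ.kerSubgroup σ s)) ∧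
    (∀ (d : decomp (K := K) v) (σ : absoluteGaloisGroup K),
      resKerD κ (W.geomPrimaryTorsion p) v (W.conjH1 p κ.kerSubgroup ((d : absoluteGaloisGroup K) * σ) s) =
        conjH1 (kerD κ v) (W.geomPrimaryTorsion p) d
          (resKerD κ (W.geomPrimaryTorsion p) v (W.conjH1 p κ.kerSubgroup σ s))) := by
  refine ⟨fun σ h hh ↦ ?_, fun d σ ↦ ?_⟩
  · rw [W.conjH1_mul_holds p κ.kerSubgroup σ h, AddMonoidHom.comp_apply, W.conjH1_of_mem_holds p κ.kerSubgroup hh,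
      AddMonoidHom.id_apply]
  · rw [W.conjH1_mul_holds p κ.kerSubgroup _ σ, AddMonoidHom.comp_apply]
    exact resKerD_conjH1 κ v d _

/-- `ker Λ ⊆ Y₀`: a class of `Sel_{𝔭′}^{S∪{v}}(K_∞)` all of whose conjugates restrict to zero on `kerD κ v` lies in
`Sel_{𝔭′}^{S}(K_∞)` (the condition at `v` is exactly `res_{kerD κ v} ∘ conj_σ = 0`, `mem_awayKer_iff_resKerD_eq_zero`).
[cite: Castella2018, Def. 2.2 (arXiv:1704.06608 p. 5)] -/
theorem mem_selmerAc_of_forall_resKerD_eq_zero (𝔭 : HeightOneSpectrum (𝓞 K)) (S : Set (HeightOneSpectrum (𝓞 K)))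
    {s : W.subgroupH1 p κ.kerSubgroup} (hs : s ∈ selmerAc W p κ 𝔭 (insert v S))
    (h0 : ∀ σ : absoluteGaloisGroup K, resKerD κ (W.geomPrimaryTorsion p) v (W.conjH1 p κ.kerSubgroup σ s) = 0) :
    s ∈ selmerAc W p κ 𝔭 S := by
  change s ∈ selmerOver κ.kerSubgroup (W.geomPrimaryTorsion p) p 𝔭 S
  change s ∈ selmerOver κ.kerSubgroup (W.geomPrimaryTorsion p) p 𝔭 (insert v S) at hs
  rw [mem_selmerOver_iff_awayKer] at hs ⊢
  refine ⟨fun u hu huS σ ↦ ?_, hs.2.1, hs.2.2⟩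
  by_cases huv : u = v
  · subst huv
    exact (mem_awayKer_iff_resKerD_eq_zero κ u _).2 (h0 σ)
  · exact hs.1 u hu (by simp [huv, huS]) σ

/-- **Division of signatures.** If `H¹(kerD κ v, M)` is `p`-divisible, so is the group of `v`-signatures: write every
`σ = d γ^i h` (`i < p^c`, exact index `κ(D_v) = p^c ℤ_p`), choose `z_i` with `p z_i = F(γ^i)` and put `G σ = conj_d z_i`
(independent of the decomposition up to `kerD`, which acts trivially). [cite: GreenbergVatsal2000, §2 p. 24]
[cite: Washington1997, §13.1] -/
theorem exists_sig_smul_eq (hvd : ¬ (decomp v ≤ κ.kerSubgroup))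
    (hdiv : ∀ y : subgroupH1 (kerD κ v) (W.geomPrimaryTorsion p),
      ∃ z : subgroupH1 (kerD κ v) (W.geomPrimaryTorsion p), p • z = y)
    (F : absoluteGaloisGroup K → subgroupH1 (kerD κ v) (W.geomPrimaryTorsion p))
    (hFH : ∀ (σ h : absoluteGaloisGroup K), h ∈ κ.kerSubgroup → F (σ * h) = F σ)
    (hFD : ∀ (d : decomp (K := K) v) (σ : absoluteGaloisGroup K), F ((d : absoluteGaloisGroup K) * σ) =
      conjH1 (kerD κ v) (W.geomPrimaryTorsion p) d (F σ)) :
    ∃ G : absoluteGaloisGroup K → subgroupH1 (kerD κ v) (W.geomPrimaryTorsion p),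
      (∀ (σ h : absoluteGaloisGroup K), h ∈ κ.kerSubgroup → G (σ * h) = G σ) ∧
      (∀ (d : decomp (K := K) v) (σ : absoluteGaloisGroup K), G ((d : absoluteGaloisGroup K) * σ) =
        conjH1 (kerD κ v) (W.geomPrimaryTorsion p) d (G σ)) ∧ p • G = F := by
  set M := W.geomPrimaryTorsion p
  obtain ⟨γ, hγ⟩ : ∃ γ : absoluteGaloisGroup K, κ.IsTopGenerator γ := κ.surjective (Multiplicative.ofAdd 1)
  obtain ⟨c, -, hc, hle⟩ := UniversalToricDescentSigmaLocalStabilizer.exists_pow_and_forall_dvd_of_not_le κ v hvd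
  choose z hz using fun i : ℕ ↦ hdiv (F (γ ^ i))
  -- the chosen decomposition of each `σ`
  choose dd ii hh hii hhh hdec using exists_decomp_mul_pow_mul_mem_ker_lt p κ v hγ hc
  -- conjugation by an element of `D_v` lying in `ker κ` is trivial on `H¹(kerD κ v, M)`
  have htriv : ∀ (e : decomp (K := K) v), (e : absoluteGaloisGroup K) ∈ κ.kerSubgroup →
      ∀ y : subgroupH1 (kerD κ v) M, conjH1 (kerD κ v) M e y = y := fun e he y ↦ by
    rw [conjH1_of_mem_holds (kerD κ v) M ((mem_kerD_iff κ v e).2 he), AddMonoidHom.id_apply]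
  -- uniqueness of the decomposition up to `kerD`
  have huniq : ∀ (σ : absoluteGaloisGroup K) (d : decomp (K := K) v) (i : ℕ) (h : absoluteGaloisGroup K),
      i < p ^ c → h ∈ κ.kerSubgroup → σ = d * γ ^ i * h →
      ii σ = i ∧ conjH1 (kerD κ v) M (dd σ) (z i) = conjH1 (kerD κ v) M d (z i) := by
    intro σ d i h hi hhm e
    have hij : ii σ = i := UniversalToricDescentSigmaLocalStabilizer.eq_of_decomp_mul_pow_mul_eq κ hγ v hle
      (hii σ) hi (hhh σ) hhm ((hdec σ).symm.trans e)
    refine ⟨hij, ?_⟩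
    -- `d⁻¹ dd σ ∈ ker κ`
    have hmem : ((d⁻¹ * dd σ : decomp (K := K) v) : absoluteGaloisGroup K) ∈ κ.kerSubgroup := by
      have e2 : (d : absoluteGaloisGroup K)⁻¹ * (dd σ : absoluteGaloisGroup K) =
          γ ^ i * (h * (hh σ)⁻¹) * (γ ^ i)⁻¹ := by
        have e3 := (hdec σ).symm.trans e
        rw [hij] at e3
        -- `dd σ * γ^i * hh σ = d * γ^i * h`
        calc (d : absoluteGaloisGroup K)⁻¹ * (dd σ : absoluteGaloisGroup K)
            = (d : absoluteGaloisGroup K)⁻¹ * ((dd σ : absoluteGaloisGroup K) * γ ^ i * hh σ) *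
                ((hh σ)⁻¹ * (γ ^ i)⁻¹) := by group
          _ = (d : absoluteGaloisGroup K)⁻¹ * ((d : absoluteGaloisGroup K) * γ ^ i * h) *
                ((hh σ)⁻¹ * (γ ^ i)⁻¹) := by rw [e3]
          _ = γ ^ i * (h * (hh σ)⁻¹) * (γ ^ i)⁻¹ := by group
      rw [Subgroup.coe_mul, Subgroup.coe_inv, e2]
      exact Subgroup.Normal.conj_mem inferInstance _ (mul_mem hhm (inv_mem (hhh σ))) _
    have e4 : dd σ = d * (d⁻¹ * dd σ) := by rw [mul_inv_cancel_left]
    rw [e4, conjH1_mul_holds (kerD κ v) M, AddMonoidHom.comp_apply, htriv _ hmem]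
  refine ⟨fun σ ↦ conjH1 (kerD κ v) M (dd σ) (z (ii σ)), fun σ h hhm ↦ ?_, fun d σ ↦ ?_, funext fun σ ↦ ?_⟩
  · -- right `ker κ`-invariance: `σ h = dd σ · γ^(ii σ) · (hh σ · h)`
    obtain ⟨h1, h2⟩ := huniq (σ * h) (dd σ) (ii σ) (hh σ * h) (hii σ) (mul_mem (hhh σ) hhm)
      (by rw [← mul_assoc, ← hdec σ])
    simp only [h1, h2]
  · -- left `D_v`-equivariance: `d σ = (d · dd σ) · γ^(ii σ) · hh σ`
    obtain ⟨h1, h2⟩ := huniq ((d : absoluteGaloisGroup K) * σ) (d * dd σ) (ii σ) (hh σ) (hii σ) (hhh σ)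
      (by rw [Subgroup.coe_mul, mul_assoc, mul_assoc, ← mul_assoc (dd σ : absoluteGaloisGroup K), ← hdec σ])
    simp only [h1, h2]
    rw [conjH1_mul_holds (kerD κ v) M, AddMonoidHom.comp_apply]
  · -- `p • G σ = F σ`
    rw [Pi.smul_apply, ← map_nsmul, hz, ← hFD, ← hFH _ (hh σ) (hhh σ), ← hdec σ]

/-- `Y[p] finite ⇒ Y[p^k] finite` for an additive subgroup `Y` (fibres of `p^k •` on `Y[p^{k+1}]` over `Y[p]` are cosets of
`Y[p^k]`). [folklore] -/
theorem finite_torsionBy_pow {A : Type*} [AddCommGroup A] (Y : AddSubgroup A) (n : ℕ)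
    (hfin : Set.Finite {s : Y | n • s = 0}) (k : ℕ) : Set.Finite {s : Y | n ^ k • s = 0} := by
  induction k with
  | zero =>
    refine (Set.finite_singleton (0 : Y)).subset fun s hs ↦ ?_
    simpa using hs
  | succ k ih =>
    -- `s ↦ n^k • s` maps `Y[n^{k+1}]` to `Y[n]` with fibres translates of `Y[n^k]`
    have hsub : {s : Y | n ^ (k + 1) • s = 0} ⊆
        ⋃ t ∈ {t : Y | n • t = 0}, (fun u : Y × Y ↦ u.1 + u.2) '' ({s : Y | n ^ k • s = 0} ×ˢ
          {s : Y | n ^ (k + 1) • s = 0 ∧ n ^ k • s = t}) := by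
      intro s hs
      simp only [Set.mem_setOf_eq] at hs
      refine Set.mem_biUnion (x := n ^ k • s) (by simp only [Set.mem_setOf_eq, ← mul_smul, ← pow_succ', hs]) ?_
      exact ⟨(0, s), ⟨by simp, hs, rfl⟩, by simp⟩
    refine Set.Finite.subset (Set.Finite.biUnion hfin fun t _ ↦ Set.Finite.image _ (ih.prod ?_)) hsub
    -- the fibre over `t` is a translate of `Y[n^k]`, hence finite
    by_cases hne : {s : Y | n ^ (k + 1) • s = 0 ∧ n ^ k • s = t}.Nonempty
    · obtain ⟨s₀, hs₀⟩ := hne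
      refine (ih.image fun u ↦ u + s₀).subset fun s hs ↦ ⟨s - s₀, ?_, by simp⟩
      simp only [Set.mem_setOf_eq, smul_sub, hs.2, hs₀.2, sub_self]
    · rw [Set.not_nonempty_iff_eq_empty.mp hne]
      exact Set.finite_empty

end Generic

end Summit.BirchSwinnertonDyer.BirchSwinnertonDyer.Theorems.UniversalToricDescentTwinSignatureDivision

end
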